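import Mathlib
import HarnessLib
import Literature.Analysis.FluidPDE.KNSSRegularityProofs

/-!
# Crux `PoloidalLiouville` (stmt-NavierStokesRegularity-1222), WALL `stub_scalarLiouville`: comparison and propagation of positivity for
# SUPERSOLUTIONS of the drift–heat class (file 1/2 of «KNSS's Lemma 2.1 for subsolutions», the one-sided engine interface)

Support file (seat leafhand-ns-unthreadeddoor-2 g5, cell decomp-ns), `--supports stmt-NavierStokesRegularity-1222 --as helper`; theorems only, general
finite-dimensional real inner product space `E`.  The tree proves KNSS's Lemma 2.1 for EXACT solutions (`KNSS2009_lemma21_halfball_holds` via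
`driftHeat_comparison` → `driftHeat_propagation`); those proofs use the integrated equation only as a LOWER bound for `v(t') − v(t)`, so they
transfer verbatim to supersolutions `∫ₛᵗ (Δv − Dv·a) ≤ v(t) − v(s)` once the joint continuity of `v` (no longer a consequence) is assumed:
`driftHeat_comparison_super`, `driftHeat_propagation_super` (this file); `DriftHeatSub.halfball_of_subsolution` (file 2/2).  WHY: in the
spherical-mean gauge the wall's deviation `T − T̄` has zero mean on spheres, so a ONE-SIDED (subsolution) engine closes the wall
(`…WallOfSphereMeanSubEngine`).  HONEST LABEL: parabolic bookkeeping copied from the tree with a one-line change each; nothing here proves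
`stub_scalarLiouville`, `PoloidalLiouville` (1222) or bears on NS regularity. [cite: Lieberman1996, Ch. II Lemma 2.1, Cor. 2.5, Lemma 2.6]
-/

noncomputable section

set_option linter.dupNamespace false

open MeasureTheory Set Function Filter Topology InnerProductSpace Metric
open scoped RealInnerProductSpace Laplacian ContDiff

namespace Summit.NavierStokesRegularity.NavierStokesRegularity.Theorems.PoloidalLiouville.Antidynamo

namespace DriftHeatSub

open Literature.Analysis.FluidPDE

variable {E : Type*} [NormedAddCommGroup E] [InnerProductSpace ℝ E] [FiniteDimensional ℝ E]
  [MeasurableSpace E] [BorelSpace E]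

/-- **Comparison principle for SUPERsolutions of the drift–heat class** (tree `driftHeat_comparison` with the equation replaced by
`∫ₛᵗ (Δv − Dv·a) ≤ v(t) − v(s)` and joint continuity of `v` assumed; proof copied). [cite: Lieberman1996, Ch. II Lemma 2.1 and Cor. 2.5 (variant)] -/
theorem driftHeat_comparison_super {v φ φₜ : ℝ → E → ℝ} {a : ℝ → E → E} {A C : ℝ} {c : E}
    {r : ℝ → ℝ} {t₁ t₂ : ℝ} (ht₂ : t₂ < 0)
    (ha_meas : Measurable (uncurry a)) (ha : ∀ t < 0, ∀ y, ‖a t y‖ ≤ A)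
    (hv2 : ∀ t < 0, ContDiff ℝ 2 (v t))
    (hbd : ∀ t < 0, ∀ y, ‖fderiv ℝ (v t) y‖ ≤ C ∧ |(Δ (v t)) y| ≤ C)
    (hcD : ContinuousOn (fun p : ℝ × E => fderiv ℝ (v p.1) p.2) (Iio 0 ×ˢ univ))
    (hcΔ : ContinuousOn (fun p : ℝ × E => (Δ (v p.1)) p.2) (Iio 0 ×ˢ univ))
    (hvc : ContinuousOn (uncurry v) (Iio 0 ×ˢ univ))
    (hsuper : ∀ y, ∀ s t : ℝ, s ≤ t → t < 0 →
      ∫ τ in s..t, ((Δ (v τ)) y - fderiv ℝ (v τ) y (a τ y)) ≤ v t y - v s y)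
    (hr : Continuous r)
    (hφc : ContinuousOn (uncurry φ) (Icc t₁ t₂ ×ˢ univ))
    (hφ2 : ∀ t ∈ Ioc t₁ t₂, ContDiff ℝ 2 (φ t))
    (hφt : ∀ t ∈ Ioc t₁ t₂, ∀ y, ‖y - c‖ < r t → HasDerivAt (fun s => φ s y) (φₜ t y) t)
    (hsub : ∀ t ∈ Ioc t₁ t₂, ∀ y, ‖y - c‖ < r t →
      φₜ t y - (Δ (φ t)) y + A * ‖fderiv ℝ (φ t) y‖ ≤ 0)
    (hbot : ∀ y, ‖y - c‖ ≤ r t₁ → φ t₁ y ≤ v t₁ y)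
    (hlat : ∀ t ∈ Icc t₁ t₂, ∀ y, ‖y - c‖ = r t → φ t y ≤ v t y) :
    ∀ t ∈ Icc t₁ t₂, ∀ y, ‖y - c‖ ≤ r t → φ t y ≤ v t y := by
  by_contra H
  push Not at H
  obtain ⟨t₀, ht₀, y₀, hy₀, hlt⟩ := H
  have ht₁₂ : t₁ ≤ t₂ := ht₀.1.trans ht₀.2
  have hA : 0 ≤ A := (norm_nonneg _).trans (ha t₂ ht₂ c)
  -- the perturbation `ε (t - t₁)`
  set δ : ℝ := φ t₀ y₀ - v t₀ y₀ with hδ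
  have hδpos : 0 < δ := sub_pos.2 hlt
  set ε : ℝ := δ / (2 * (t₂ - t₁ + 1)) with hε
  have hεpos : 0 < ε := div_pos hδpos (by linarith)
  have hεδ : ε * (t₀ - t₁) < δ := by
    have h1 : ε * (t₀ - t₁) ≤ ε * (t₂ - t₁ + 1) :=
      mul_le_mul_of_nonneg_left (by linarith [ht₀.2]) hεpos.le
    have hT : 0 < t₂ - t₁ + 1 := by linarith
    have h2 : ε * (t₂ - t₁ + 1) = δ / 2 := by
      rw [hε, div_mul_eq_mul_div, mul_div_mul_right _ _ hT.ne']
    linarith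
  -- the compact region `K` and the function `g`
  set K : Set (ℝ × E) := {p | p.1 ∈ Icc t₁ t₂ ∧ ‖p.2 - c‖ ≤ r p.1} with hK
  set g : ℝ × E → ℝ := fun p => φ p.1 p.2 - v p.1 p.2 - ε * (p.1 - t₁) with hg
  obtain ⟨ρ, hρ⟩ : ∃ ρ, ∀ t ∈ Icc t₁ t₂, r t ≤ ρ := by
    obtain ⟨ρ, hρ⟩ := isCompact_Icc.bddAbove_image (f := r) hr.continuousOn
    exact ⟨ρ, fun t ht => hρ (mem_image_of_mem r ht)⟩
  have hKc : IsCompact K := by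
    refine ((isCompact_Icc (a := t₁) (b := t₂)).prod
      (isCompact_closedBall c ρ)).of_isClosed_subset ?_ ?_
    · refine IsClosed.inter (isClosed_Icc.preimage continuous_fst) ?_
      exact isClosed_le (by fun_prop) (hr.comp continuous_fst)
    · rintro ⟨t, y⟩ ⟨ht, hy⟩
      exact ⟨ht, mem_closedBall_iff_norm.2 (hy.trans (hρ t ht))⟩
  have hKsub : K ⊆ Iio 0 ×ˢ univ := fun p hp => ⟨lt_of_le_of_lt hp.1.2 ht₂, mem_univ _⟩
  have hgc : ContinuousOn g K := by
    have h1 : ContinuousOn (uncurry φ) K := hφc.mono fun p hp => ⟨hp.1, mem_univ _⟩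
    have h2 : ContinuousOn (uncurry v) K := hvc.mono hKsub
    have h3 : Continuous fun p : ℝ × E => ε * (p.1 - t₁) := by fun_prop
    exact (h1.sub h2).sub h3.continuousOn
  -- a maximum point of `g` on `K`
  have hKne : K.Nonempty := ⟨(t₀, y₀), ht₀, hy₀⟩
  obtain ⟨⟨t', y'⟩, ⟨ht', hy'⟩, hmax⟩ := hKc.exists_isMaxOn hKne hgc
  simp only at ht' hy'
  have hmax' : ∀ t ∈ Icc t₁ t₂, ∀ y, ‖y - c‖ ≤ r t →
      φ t y - v t y - ε * (t - t₁) ≤ φ t' y' - v t' y' - ε * (t' - t₁) :=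
    fun t ht y hy => hmax (show (t, y) ∈ K from ⟨ht, hy⟩)
  have hpos : 0 < φ t' y' - v t' y' - ε * (t' - t₁) := by
    have := hmax' t₀ ht₀ y₀ hy₀
    linarith
  -- the maximum point is neither on the bottom nor on the lateral boundary
  have ht'1 : t₁ < t' := by
    rcases eq_or_lt_of_le ht'.1 with h | h
    · exfalso
      have hb := hbot y' (h ▸ hy')
      rw [← h] at hpos
      simp only [sub_self, mul_zero, sub_zero] at hpos
      linarith
    · exact h
  have ht'I : t' ∈ Ioc t₁ t₂ := ⟨ht'1, ht'.2⟩
  have ht'0 : t' < 0 := lt_of_le_of_lt ht'.2 ht₂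
  have hy'lt : ‖y' - c‖ < r t' := by
    rcases eq_or_lt_of_le hy' with h | h
    · exfalso
      have hl := hlat t' ht' y' h
      have : 0 ≤ ε * (t' - t₁) := mul_nonneg hεpos.le (by linarith)
      linarith
    · exact h
  -- first- and second-order conditions in space at `(t', y')`
  have hloc : IsLocalMax (fun y => φ t' y - v t' y) y' := by
    have hopen : IsOpen {y : E | ‖y - c‖ < r t'} := isOpen_lt (by fun_prop) continuous_const
    filter_upwards [hopen.mem_nhds hy'lt] with y hy
    have := hmax' t' ht' y (le_of_lt hy)
    linarith
  have hF : ContDiff ℝ 2 (fun y => φ t' y - v t' y) := (hφ2 t' ht'I).sub (hv2 t' ht'0)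
  have hgrad : fderiv ℝ (φ t') y' = fderiv ℝ (v t') y' := by
    have h0 := hloc.fderiv_eq_zero
    rw [fderiv_fun_sub ((hφ2 t' ht'I).differentiable (by norm_num) y')
      ((hv2 t' ht'0).differentiable (by norm_num) y')] at h0
    exact sub_eq_zero.1 h0
  have hlap : (Δ (φ t')) y' ≤ (Δ (v t')) y' := by
    have h0 := laplacian_nonpos_of_isLocalMax hF hloc
    have h1 : (Δ (fun y => φ t' y - v t' y)) y' = (Δ (φ t')) y' - (Δ (v t')) y' :=
      ((hφ2 t' ht'I).contDiffAt (x := y')).laplacian_sub ((hv2 t' ht'0).contDiffAt)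
    linarith
  -- neighbourhoods in time
  set η : ℝ := ε / (4 * (1 + A)) with hη
  have hηpos : 0 < η := div_pos hεpos (by linarith)
  -- (i) `y'` stays strictly inside the moving ball
  have h1 : ∀ᶠ t in 𝓝 t', ‖y' - c‖ < r t :=
    (hr.continuousAt (x := t')).eventually (isOpen_Ioi.mem_nhds hy'lt)
  -- (ii) joint continuity of `Δ v` and `∇v` at `(t', y')`
  have hnhds : Iio (0 : ℝ) ×ˢ (univ : Set E) ∈ 𝓝 (t', y') :=
    (isOpen_Iio.prod isOpen_univ).mem_nhds ⟨ht'0, mem_univ _⟩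
  have hγ : Continuous fun τ : ℝ => (τ, y') := by fun_prop
  have h2 : ∀ᶠ τ in 𝓝 t', |(Δ (v τ)) y' - (Δ (v t')) y'| < η := by
    have hc : ContinuousAt (fun τ : ℝ => (Δ (v τ)) y') t' := by
      have := ContinuousAt.comp (f := fun τ : ℝ => (τ, y')) (x := t') (hcΔ.continuousAt hnhds)
        hγ.continuousAt
      exact this
    have := (Metric.tendsto_nhds.1 hc) η hηpos
    simpa [Real.dist_eq] using this
  have h3 : ∀ᶠ τ in 𝓝 t', ‖fderiv ℝ (v τ) y' - fderiv ℝ (v t') y'‖ < η := by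
    have hc : ContinuousAt (fun τ : ℝ => fderiv ℝ (v τ) y') t' := by
      have := ContinuousAt.comp (f := fun τ : ℝ => (τ, y')) (x := t') (hcD.continuousAt hnhds)
        hγ.continuousAt
      exact this
    have := (Metric.tendsto_nhds.1 hc) η hηpos
    simpa [dist_eq_norm] using this
  -- (iii) differentiability of `φ(·, y')` at `t'`
  have h4 : ∀ᶠ t in 𝓝 t', |φ t y' - φ t' y' - (t - t') * φₜ t' y'| ≤ ε / 4 * |t - t'| := by
    have hd := hφt t' ht'I y' hy'lt
    rw [hasDerivAt_iff_isLittleO] at hd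
    have := hd.def (show (0 : ℝ) < ε / 4 by linarith)
    simpa only [smul_eq_mul, Real.norm_eq_abs] using this
  -- choose a time `t < t'` in all these neighbourhoods, with `t₁ ≤ t`
  obtain ⟨d, hdpos, hd⟩ := Metric.eventually_nhds_iff.1 (h1.and (h2.and (h3.and h4)))
  set t : ℝ := max t₁ (t' - d / 2) with htdef
  have htt' : t < t' := max_lt ht'1 (by linarith)
  have ht₁t : t₁ ≤ t := le_max_left _ _
  have htd : t' - d / 2 ≤ t := le_max_right _ _
  have hdist : ∀ τ ∈ Icc t t', dist τ t' < d := fun τ hτ => by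
    rw [Real.dist_eq, abs_sub_comm, abs_of_nonneg (by linarith [hτ.2])]
    linarith [hτ.1]
  have htI : t ∈ Icc t₁ t₂ := ⟨ht₁t, htt'.le.trans ht'.2⟩
  have ht0 : t < 0 := htt'.trans ht'0
  obtain ⟨hrt, -, -, hφ4⟩ := hd (hdist t ⟨le_rfl, htt'.le⟩)
  -- `g (t, y') ≤ g (t', y')`
  have hgt := hmax' t htI y' hrt.le
  -- lower bound for `v t' y' - v t y'` from the equation
  set L : ℝ := (Δ (φ t')) y' - A * ‖fderiv ℝ (φ t') y'‖ - η * (1 + A) with hL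
  have hlow : L * (t' - t) ≤ v t' y' - v t y' := by
    refine le_trans ?_ (hsuper y' t t' htt'.le ht'0)
    have hint := driftHeat_intervalIntegrable ha_meas ha hbd hcD hcΔ y' htt'.le ht'0
    have hmono := intervalIntegral.integral_mono_on htt'.le
      (intervalIntegrable_const (μ := volume) (a := t) (b := t') (c := L)) hint
      (fun τ hτ => ?_)
    · simpa [intervalIntegral.integral_const, smul_eq_mul, mul_comm] using hmono
    · -- pointwise lower bound of the integrand on `[t, t']`
      have hτ0 : τ < 0 := lt_of_le_of_lt hτ.2 ht'0
      obtain ⟨-, hΔτ, hDτ, -⟩ := hd (hdist τ hτ)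
      have e1 : (Δ (v t')) y' - η < (Δ (v τ)) y' := by
        have := (abs_lt.1 hΔτ).1
        linarith
      have e2 : fderiv ℝ (v τ) y' (a τ y') ≤ A * ‖fderiv ℝ (φ t') y'‖ + η * A := by
        have f1 : fderiv ℝ (v τ) y' (a τ y') =
            fderiv ℝ (v t') y' (a τ y') + (fderiv ℝ (v τ) y' - fderiv ℝ (v t') y') (a τ y') := by
          rw [sub_apply]; ring
        have f2 : fderiv ℝ (v t') y' (a τ y') ≤ A * ‖fderiv ℝ (φ t') y'‖ := by
          rw [← hgrad]
          refine (le_abs_self _).trans ?_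
          rw [← Real.norm_eq_abs]
          refine (ContinuousLinearMap.le_opNorm _ _).trans ?_
          rw [mul_comm]
          exact mul_le_mul_of_nonneg_right (ha τ hτ0 y') (norm_nonneg _)
        have f3 : (fderiv ℝ (v τ) y' - fderiv ℝ (v t') y') (a τ y') ≤ η * A := by
          refine (le_abs_self _).trans ?_
          rw [← Real.norm_eq_abs]
          refine (ContinuousLinearMap.le_opNorm _ _).trans ?_
          exact mul_le_mul hDτ.le (ha τ hτ0 y') (norm_nonneg _) hηpos.le
        linarith
      rw [hL]
      linarith
  -- upper bound for `φ t' y' - φ t y'` from the time derivative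
  have hup : φ t' y' - φ t y' ≤ (t' - t) * (φₜ t' y' + ε / 4) := by
    have := (abs_le.1 hφ4).1
    rw [abs_sub_comm, abs_of_nonneg (by linarith : (0 : ℝ) ≤ t' - t)] at this
    nlinarith
  -- the subsolution inequality at `(t', y')`
  have hs := hsub t' ht'I y' hy'lt
  -- combine
  have hkey : L * (t' - t) ≤ (t' - t) * (φₜ t' y' + ε / 4) - ε * (t' - t) := by linarith
  have hpos' : 0 < t' - t := by linarith
  have hkey' : L ≤ φₜ t' y' + ε / 4 - ε := by
    by_contra hcon
    push Not at hcon
    nlinarith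
  have hηA : η * (1 + A) = ε / 4 := by
    rw [hη]; field_simp
  rw [hL] at hkey'
  linarith

/-- **Propagation of positivity for nonnegative SUPERsolutions** (tree `driftHeat_propagation`, equation replaced by the one-sided
inequality; proof copied). [cite: Lieberman1996, Ch. II Lemma 2.6 (variant)] -/
theorem driftHeat_propagation_super {v : ℝ → E → ℝ} {a : ℝ → E → E} {A C μ R : ℝ}
    (ha_meas : Measurable (uncurry a)) (ha : ∀ t < 0, ∀ y, ‖a t y‖ ≤ A)
    (hv2 : ∀ t < 0, ContDiff ℝ 2 (v t))
    (hbd : ∀ t < 0, ∀ y, ‖fderiv ℝ (v t) y‖ ≤ C ∧ |(Δ (v t)) y| ≤ C)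
    (hcD : ContinuousOn (fun p : ℝ × E => fderiv ℝ (v p.1) p.2) (Iio 0 ×ˢ univ))
    (hcΔ : ContinuousOn (fun p : ℝ × E => (Δ (v p.1)) p.2) (Iio 0 ×ˢ univ))
    (hvc : ContinuousOn (uncurry v) (Iio 0 ×ˢ univ))
    (hsuper : ∀ y, ∀ s t : ℝ, s ≤ t → t < 0 →
      ∫ τ in s..t, ((Δ (v τ)) y - fderiv ℝ (v τ) y (a τ y)) ≤ v t y - v s y)
    (hv0 : ∀ t < 0, ∀ y, 0 ≤ v t y) (hμ : 0 < μ) (hR : 0 < R) :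
    ∃ ε₀ > 0, ∀ t₁ < 0, ∀ y₁, μ < v t₁ y₁ →
      ∀ t ∈ Icc (t₁ + 1) (t₁ + 1 + R ^ 2), t < 0 → ∀ y, ‖y - y₁‖ < R → ε₀ ≤ v t y := by
  have hA : 0 ≤ A := (norm_nonneg _).trans (ha (-1) (by norm_num) 0)
  have hC : 0 ≤ C := (norm_nonneg _).trans (hbd (-1) (by norm_num) 0).1
  -- the constants of the barrier
  obtain ⟨d, hd⟩ : ∃ d : ℝ, d = (Module.finrank ℝ E : ℝ) := ⟨_, rfl⟩
  obtain ⟨r₀, hr₀def⟩ : ∃ r₀ : ℝ, r₀ = μ / (2 * (C + 1)) := ⟨_, rfl⟩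
  obtain ⟨κ, hκdef⟩ : ∃ κ : ℝ, κ = 2 * R := ⟨_, rfl⟩
  obtain ⟨ρmax, hρmaxdef⟩ : ∃ ρmax : ℝ, ρmax = r₀ + κ * (1 + R ^ 2) := ⟨_, rfl⟩
  obtain ⟨B, hB⟩ : ∃ B : ℝ, B = 2 * κ / r₀ + 2 * d / r₀ ^ 2 + 2 * A / r₀ := ⟨_, rfl⟩
  obtain ⟨n, hn⟩ : ∃ n : ℕ, n = ⌈B * ρmax ^ 2 / 4⌉₊ := ⟨_, rfl⟩
  obtain ⟨l, hl⟩ : ∃ l : ℝ, l = (n + 2) * B := ⟨_, rfl⟩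
  obtain ⟨m₀, hm₀⟩ : ∃ m₀ : ℝ, m₀ = μ / 2 := ⟨_, rfl⟩
  have hr₀ : 0 < r₀ := by rw [hr₀def]; positivity
  have hκ : 0 ≤ κ := by rw [hκdef]; positivity
  have hd0 : 0 ≤ d := by rw [hd]; positivity
  have hB0 : 0 ≤ B := by rw [hB]; positivity
  have hl0 : 0 ≤ l := by rw [hl]; positivity
  have hm₀0 : 0 < m₀ := by rw [hm₀]; positivity
  have hnB : B * ρmax ^ 2 ≤ 4 * (n + 1) := by
    have h1 : B * ρmax ^ 2 / 4 ≤ n := by rw [hn]; exact Nat.le_ceil _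
    linarith
  have hlB : (n + 2) * (2 * κ / r₀ + 2 * Module.finrank ℝ E / r₀ ^ 2 + 2 * A / r₀) ≤ l := by
    rw [hl, hB, hd]
  have hnB' : (2 * κ / r₀ + 2 * Module.finrank ℝ E / r₀ ^ 2 + 2 * A / r₀) * ρmax ^ 2 ≤
      4 * (n + 1) := by rwa [hB, hd] at hnB
  refine ⟨m₀ * Real.exp (-l * (1 + R ^ 2)) * (3 / 4) ^ (n + 2), by positivity, ?_⟩
  intro t₁ ht₁ y₁ hμ₁ t ht ht0 y hy
  -- abbreviations for the barrier data centred at `y₁`, started at `t₁`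
  have hrad : Continuous (knssRad r₀ κ t₁) := by
    have : knssRad r₀ κ t₁ = fun s => r₀ + κ * (s - t₁) := rfl
    rw [this]
    fun_prop
  have hrad_pos : ∀ s, t₁ ≤ s → 0 < knssRad r₀ κ t₁ s := fun s hs =>
    hr₀.trans_le (le_knssRad hκ hs)
  have hrad_t : knssRad r₀ κ t₁ t ≤ ρmax := by
    rw [hρmaxdef, knssRad]
    have : t - t₁ ≤ 1 + R ^ 2 := by linarith [ht.2]
    have := mul_le_mul_of_nonneg_left this hκ
    linarith
  -- hypotheses of the comparison principle
  have hφc : ContinuousOn (uncurry (knssBarrier y₁ m₀ l r₀ κ t₁ n)) (Icc t₁ t ×ˢ univ) := by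
    have e : uncurry (knssBarrier y₁ m₀ l r₀ κ t₁ n) = fun p : ℝ × E =>
        m₀ * Real.exp (-l * (p.1 - t₁)) *
          (1 - ‖p.2 - y₁‖ ^ 2 / knssRad r₀ κ t₁ p.1 ^ 2) ^ (n + 2) := by
      funext ⟨s, z⟩
      rfl
    rw [e]
    have h1 : Continuous fun p : ℝ × E => m₀ * Real.exp (-l * (p.1 - t₁)) := by fun_prop
    have h2 : Continuous fun p : ℝ × E => ‖p.2 - y₁‖ ^ 2 := by fun_prop
    have h3 : Continuous fun p : ℝ × E => knssRad r₀ κ t₁ p.1 ^ 2 :=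
      (hrad.comp continuous_fst).pow 2
    have h4 : ∀ p ∈ Icc t₁ t ×ˢ (univ : Set E), knssRad r₀ κ t₁ p.1 ^ 2 ≠ 0 :=
      fun p hp => pow_ne_zero 2 (hrad_pos p.1 hp.1.1).ne'
    exact h1.continuousOn.mul
      ((continuousOn_const.sub (h2.continuousOn.div h3.continuousOn h4)).pow _)
  have hφ2 : ∀ s ∈ Ioc t₁ t, ContDiff ℝ 2 (knssBarrier y₁ m₀ l r₀ κ t₁ n s) := by
    intro s _
    exact contDiff_knssBarrier y₁ m₀ l r₀ κ t₁ n s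
  have hφt : ∀ s ∈ Ioc t₁ t, ∀ z, ‖z - y₁‖ < knssRad r₀ κ t₁ s →
      HasDerivAt (fun s' => knssBarrier y₁ m₀ l r₀ κ t₁ n s' z)
        (knssBarrierDt y₁ m₀ l r₀ κ t₁ n s z) s := by
    intro s hs z _
    exact hasDerivAt_knssBarrier_time y₁ m₀ l r₀ κ t₁ n z (hrad_pos s hs.1.le).ne'
  have hsub : ∀ s ∈ Ioc t₁ t, ∀ z, ‖z - y₁‖ < knssRad r₀ κ t₁ s →
      knssBarrierDt y₁ m₀ l r₀ κ t₁ n s z - (Δ (knssBarrier y₁ m₀ l r₀ κ t₁ n s)) z +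
        A * ‖fderiv ℝ (knssBarrier y₁ m₀ l r₀ κ t₁ n s) z‖ ≤ 0 := by
    intro s hs z hz
    exact knssBarrier_subsolution hA hκ hr₀ hm₀0.le hlB hnB' hs.1.le
      ((knssRad_mono hκ hs.2).trans hrad_t) hz.le
  have hbot : ∀ z, ‖z - y₁‖ ≤ knssRad r₀ κ t₁ t₁ → knssBarrier y₁ m₀ l r₀ κ t₁ n t₁ z ≤ v t₁ z := by
    intro z hz
    have hrad₁ : knssRad r₀ κ t₁ t₁ = r₀ := by simp [knssRad]
    rw [hrad₁] at hz
    have hq1 : ‖z - y₁‖ ^ 2 / r₀ ^ 2 ≤ 1 := by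
      rw [div_le_one (by positivity)]
      exact pow_le_pow_left₀ (norm_nonneg _) hz 2
    have hq0 : 0 ≤ ‖z - y₁‖ ^ 2 / r₀ ^ 2 := by positivity
    have hφ : knssBarrier y₁ m₀ l r₀ κ t₁ n t₁ z ≤ m₀ := by
      have e : knssBarrier y₁ m₀ l r₀ κ t₁ n t₁ z = m₀ * (1 - ‖z - y₁‖ ^ 2 / r₀ ^ 2) ^ (n + 2) := by
        simp [knssBarrier, knssProfile, hrad₁]
      rw [e]
      have : (1 - ‖z - y₁‖ ^ 2 / r₀ ^ 2) ^ (n + 2) ≤ 1 := pow_le_one₀ (by linarith) (by linarith)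
      calc m₀ * (1 - ‖z - y₁‖ ^ 2 / r₀ ^ 2) ^ (n + 2) ≤ m₀ * 1 :=
          mul_le_mul_of_nonneg_left this hm₀0.le
        _ = m₀ := mul_one _
    have hv : m₀ ≤ v t₁ z := by
      have h1 := driftHeat_abs_sub_space_le ((hv2 t₁ ht₁).differentiable (by norm_num))
        (fun w => (hbd t₁ ht₁ w).1) z y₁
      have h2 : C * ‖z - y₁‖ ≤ μ / 2 := by
        have h3 : C * r₀ ≤ μ / 2 := by
          rw [hr₀def]
          rw [show C * (μ / (2 * (C + 1))) = μ / 2 * (C / (C + 1)) by field_simp]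
          have : C / (C + 1) ≤ 1 := by
            rw [div_le_one (by linarith)]
            linarith
          calc μ / 2 * (C / (C + 1)) ≤ μ / 2 * 1 := mul_le_mul_of_nonneg_left this (by linarith)
            _ = μ / 2 := mul_one _
        exact (mul_le_mul_of_nonneg_left hz hC).trans h3
      have h4 := (abs_le.1 (h1.trans h2)).1
      rw [hm₀]
      linarith
    exact hφ.trans hv
  have hlat : ∀ s ∈ Icc t₁ t, ∀ z, ‖z - y₁‖ = knssRad r₀ κ t₁ s →
      knssBarrier y₁ m₀ l r₀ κ t₁ n s z ≤ v s z := by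
    intro s hs z hz
    have hρ := hrad_pos s hs.1
    have e : knssBarrier y₁ m₀ l r₀ κ t₁ n s z = 0 := by
      rw [knssBarrier, knssProfile, hz, div_self (pow_ne_zero 2 hρ.ne'), sub_self,
        zero_pow (by positivity), mul_zero]
    rw [e]
    exact hv0 s (lt_of_le_of_lt hs.2 ht0) z
  -- the comparison principle on `[t₁, t]`
  have key : ∀ s ∈ Icc t₁ t, ∀ z, ‖z - y₁‖ ≤ knssRad r₀ κ t₁ s →
      knssBarrier y₁ m₀ l r₀ κ t₁ n s z ≤ v s z := by
    exact driftHeat_comparison_super (φ := knssBarrier y₁ m₀ l r₀ κ t₁ n)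
      (φₜ := knssBarrierDt y₁ m₀ l r₀ κ t₁ n) ht0 ha_meas ha hv2 hbd hcD hcΔ hvc hsuper hrad hφc hφ2 hφt
      hsub hbot hlat
  -- evaluate the barrier at `(t, y)`
  have ht₁t : t₁ ≤ t := by linarith [ht.1]
  have hρt : 2 * R ≤ knssRad r₀ κ t₁ t := by
    rw [knssRad, hκdef]
    have : 1 ≤ t - t₁ := by linarith [ht.1]
    have := mul_le_mul_of_nonneg_left this (by positivity : (0 : ℝ) ≤ 2 * R)
    linarith
  have hyρ : ‖y - y₁‖ ≤ knssRad r₀ κ t₁ t := by linarith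
  have hle : knssBarrier y₁ m₀ l r₀ κ t₁ n t y ≤ v t y := by
    exact key t ⟨ht₁t, le_rfl⟩ y hyρ
  refine le_trans ?_ hle
  -- `ε₀ ≤ φ(t, y)`
  have hρ0 : 0 < knssRad r₀ κ t₁ t := hrad_pos t ht₁t
  have hq : ‖y - y₁‖ ^ 2 / knssRad r₀ κ t₁ t ^ 2 ≤ 1 / 4 := by
    rw [div_le_div_iff₀ (by positivity) (by norm_num : (0 : ℝ) < 4)]
    have h1 : ‖y - y₁‖ ^ 2 ≤ R ^ 2 := pow_le_pow_left₀ (norm_nonneg _) hy.le 2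
    have h2 : (2 * R) ^ 2 ≤ knssRad r₀ κ t₁ t ^ 2 := pow_le_pow_left₀ (by positivity) hρt 2
    calc ‖y - y₁‖ ^ 2 * 4 ≤ R ^ 2 * 4 := by gcongr
      _ = (2 * R) ^ 2 := by ring
      _ ≤ knssRad r₀ κ t₁ t ^ 2 := h2
      _ = 1 * knssRad r₀ κ t₁ t ^ 2 := (one_mul _).symm
  have hexp : Real.exp (-l * (1 + R ^ 2)) ≤ Real.exp (-l * (t - t₁)) := by
    apply Real.exp_le_exp.2
    have : t - t₁ ≤ 1 + R ^ 2 := by linarith [ht.2]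
    exact mul_le_mul_of_nonpos_left this (by linarith)
  have hpow : (3 / 4 : ℝ) ^ (n + 2) ≤ (1 - ‖y - y₁‖ ^ 2 / knssRad r₀ κ t₁ t ^ 2) ^ (n + 2) :=
    pow_le_pow_left₀ (by norm_num) (by linarith) _
  have e : knssBarrier y₁ m₀ l r₀ κ t₁ n t y =
      m₀ * Real.exp (-l * (t - t₁)) * (1 - ‖y - y₁‖ ^ 2 / knssRad r₀ κ t₁ t ^ 2) ^ (n + 2) := rfl
  rw [e]
  exact mul_le_mul (mul_le_mul_of_nonneg_left hexp hm₀0.le) hpow (by positivity) (by positivity)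

end DriftHeatSub

end Summit.NavierStokesRegularity.NavierStokesRegularity.Theorems.PoloidalLiouville.Antidynamo
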